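import Literature.Geometry.Symplectic.SelfDualTripleFrame
import Literature.Geometry.Symplectic.NearSymplecticDefinite
import HarnessLib

/-!
# Adapted frames at a definite transverse zero of a `2`-form on a `4`-manifold

Topic `Literature/Geometry/Symplectic` (groundwork `--supports`
`Literature.Geometry.Symplectic.relNearSymplecticTaubesTubes_exists`; everything here is PROVED,
no named fact is introduced).

Step H-a3 of the normal form along an even zero circle of a STRICTLY near-symplectic form (Honda
2004, §4 Thm. 5; Perutz 2006, Lemma 3.1, which begins "take a metric `g` for which `ω` is
self-dual"; cf. `NearSymplecticDefinite.lean`): the pointwise linear algebra producing, at a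
definite transverse zero, a frame of the tangent space with PRESCRIBED first vector `τ` (the
tangent of the zero set) in which the intrinsic gradient takes values in the standard self-dual
forms — Perutz 2006, Lemma 2.1 (b) ("positive-definite three-plane sub-bundles `Λ⁺ ⊂ Λ²` having
`ω` as section" ↔ conformal structures) combined with the quaternionic frame of
`SelfDualTripleFrame.lean`:

* bilinearity of the wedge pairing `pfaffianPair` (`pfaffianPair_add_left`, …) and
  **Gram–Schmidt in a definite three-plane** `V ⊂ Λ²(ℝ⁴)*` (`Pf` of sign `s = ±1` on `V ∖ 0`):
  `exists_wedgeOrthonormalTriple_of_definite` — a wedge-orthonormal triple `η` in `V` with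
  `Pf(η_i) = s`, triangular in a given basis of `V`; every combination `ζ` of the `η_k` is
  `ζ = Σ_k (⟨ζ, η_k⟩ / 2s) η_k` (`eq_sum_pfaffianPair_smul`);
* **adapted frame for a gradient with definite image** (`exists_adaptedFrame_of_definiteImage`):
  for a linear `G : ℝ⁴ → Λ²(ℝ⁴)*` of rank `3` whose non-zero values have `Pf` of sign `s`, and
  `τ ≠ 0` with `G τ = 0`, there are `A ∈ GL(ℝ⁴)` with `A e₀ = τ`, `c ≠ 0` and a wedge-orthonormal
  triple `η` in `im G` with `η_i(Au, Av) = c β_i(u, v)` (`β_i = hondaBeta_i`) and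
  `G W = Σ_k (⟨G W, η_k⟩/2s) η_k`, so that `G(AW)(AU, AV) = c Σ_k (⟨G(AW), η_k⟩/2s) β_k(U, V)`:
  in the frame `A` the gradient is `x ↦ x · S · β` as in Perutz 2006, §3 (proof of Lemma 3.1,
  "`ω(t, x) = x · S(t) β + O(|x|²)`");
* the near-symplectic corollary `IsPositiveZero.exists_adaptedFrame`: at a positive zero `x` of
  `α` (for the orientation `o`), with `τ ≠ 0` in the kernel of `∇α(x)`, such `A, c, η` exist for
  `G = zeroGradient α x` and the sign `s` of `o x` relative to the chart.

## References

* T. Perutz, *Zero-sets of near-symplectic forms*, J. Symplectic Geom. 4 (2006), Lemma 2.1 (b),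
  §3 proof of Lemma 3.1 [Perutz2006].
* K. Honda, *Local properties of self-dual harmonic 2-forms on a 4-manifold*, J. reine angew.
  Math. 577 (2004), §4 Thm. 4 (A), Thm. 5 [Honda2004LocalSD].
-/

noncomputable section

open Set Function Module Literature.Geometry.Kaehler Literature.Topology.FourManifolds
open scoped Manifold ContDiff

namespace Literature.Geometry.Symplectic

/-- Local notation for the model space `ℝ⁴ = EuclideanSpace ℝ (Fin 4)`. -/
local notation "E4" => EuclideanSpace ℝ (Fin 4)

/-! ### Bilinearity of the wedge pairing -/

section Bilinear

variable (α β γ : E4 [⋀^Fin 2]→L[ℝ] ℝ)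

/-- The wedge pairing is additive on the left. [folklore] -/
theorem pfaffianPair_add_left : pfaffianPair (α + β) γ = pfaffianPair α γ + pfaffianPair β γ := by
  simp only [pfaffianPair_eq, ContinuousAlternatingMap.add_apply]; ring

/-- The wedge pairing is homogeneous on the left. [folklore] -/
theorem pfaffianPair_smul_left (c : ℝ) : pfaffianPair (c • α) β = c * pfaffianPair α β := by
  simp only [pfaffianPair_eq, ContinuousAlternatingMap.smul_apply, smul_eq_mul]; ring

/-- The wedge pairing is additive on the right. [folklore] -/
theorem pfaffianPair_add_right : pfaffianPair α (β + γ) = pfaffianPair α β + pfaffianPair α γ := by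
  simp only [pfaffianPair_eq, ContinuousAlternatingMap.add_apply]; ring

/-- The wedge pairing is homogeneous on the right. [folklore] -/
theorem pfaffianPair_smul_right (c : ℝ) : pfaffianPair α (c • β) = c * pfaffianPair α β := by
  simp only [pfaffianPair_eq, ContinuousAlternatingMap.smul_apply, smul_eq_mul]; ring

/-- The wedge pairing of a difference on the right. [folklore] -/
theorem pfaffianPair_sub_right : pfaffianPair α (β - γ) = pfaffianPair α β - pfaffianPair α γ := by
  simp only [pfaffianPair_eq, ContinuousAlternatingMap.sub_apply]; ring

/-- The wedge pairing with `0` on the left vanishes. [folklore] -/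
@[simp] theorem pfaffianPair_zero_left : pfaffianPair 0 β = 0 := by
  simp [pfaffianPair_eq]

/-- The wedge pairing of a finite combination on the left. [folklore] -/
theorem pfaffianPair_sum_smul_left (a : Fin 3 → ℝ) (η : Fin 3 → E4 [⋀^Fin 2]→L[ℝ] ℝ) :
    pfaffianPair (∑ k, a k • η k) β = ∑ k, a k * pfaffianPair (η k) β := by
  simp only [Fin.sum_univ_three, pfaffianPair_add_left, pfaffianPair_smul_left]

end Bilinear

/-! ### Gram–Schmidt in a definite three-plane of `2`-forms -/

section GramSchmidt

variable {s : ℝ}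

/-- **Normalisation**: if `s Pf(ζ) > 0` (`s = ±1`) then `ζ/√(s Pf ζ)` has Pfaffian `s`. [folklore] -/
theorem pfaffian_normalize (hs : s = 1 ∨ s = -1) {ζ : E4 [⋀^Fin 2]→L[ℝ] ℝ}
    (hζ : 0 < s * pfaffian ζ) : pfaffian ((Real.sqrt (s * pfaffian ζ))⁻¹ • ζ) = s := by
  have hP : pfaffian ζ ≠ 0 := by
    intro h0
    rw [h0, mul_zero] at hζ
    exact lt_irrefl _ hζ
  rw [pfaffian_smul, inv_pow, Real.sq_sqrt hζ.le, mul_inv, mul_assoc, inv_mul_cancel₀ hP, mul_one]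
  rcases hs with rfl | rfl <;> norm_num

/-- **Orthogonalisation** against a form of Pfaffian `s ≠ 0`:
`⟨η, ζ − (⟨η, ζ⟩/2s) η⟩ = 0`. [folklore] -/
theorem pfaffianPair_orthogonalize (hs0 : s ≠ 0) {η : E4 [⋀^Fin 2]→L[ℝ] ℝ} (hη : pfaffian η = s)
    (ζ : E4 [⋀^Fin 2]→L[ℝ] ℝ) :
    pfaffianPair η (ζ - (pfaffianPair η ζ / (2 * s)) • η) = 0 := by
  rw [pfaffianPair_sub_right, pfaffianPair_smul_right, pfaffianPair_self, hη]
  field_simp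
  ring

/-- A combination `Σ a_i ζ_i` of a linearly independent triple with some `a_k ≠ 0` is non-zero.
[folklore] -/
theorem sum_smul_ne_zero_of_linearIndependent {ζ : Fin 3 → E4 [⋀^Fin 2]→L[ℝ] ℝ}
    (hli : LinearIndependent ℝ ζ) (a : Fin 3 → ℝ) (k : Fin 3) (hk : a k ≠ 0) :
    ∑ i, a i • ζ i ≠ 0 := fun h0 =>
  hk (Fintype.linearIndependent_iff.1 hli a h0 k)

/-- **Gram–Schmidt in a definite three-plane.**  Let `ζ₀, ζ₁, ζ₂` be linearly independent
`2`-forms on `ℝ⁴` on whose span the Pfaffian has the constant sign `s = ±1` off `0`.  Then the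
span contains a wedge-orthonormal triple `η` of Pfaffian `s`, triangular in `ζ` — so that,
conversely, each `ζ_i` is a combination of the `η_k` (Perutz 2006, Lemma 2.1 (b): a definite
three-plane has an orthonormal basis for the wedge-square form; the usual Gram–Schmidt process,
written with explicit coefficients). [cite: Perutz2006, Lemma 2.1 (b)] -/
theorem exists_wedgeOrthonormalTriple_of_definite (hs : s = 1 ∨ s = -1)
    (ζ : Fin 3 → E4 [⋀^Fin 2]→L[ℝ] ℝ) (hli : LinearIndependent ℝ ζ)
    (hdef : ∀ a : Fin 3 → ℝ, ∑ i, a i • ζ i ≠ 0 → 0 < s * pfaffian (∑ i, a i • ζ i)) :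
    ∃ (η : Fin 3 → E4 [⋀^Fin 2]→L[ℝ] ℝ) (m n : Fin 3 → Fin 3 → ℝ),
      (∀ k, η k = ∑ i, m k i • ζ i) ∧ (∀ i, ζ i = ∑ k, n i k • η k) ∧
      IsWedgeOrthonormalTriple (η 0) (η 1) (η 2) s := by
  have hs0 : s ≠ 0 := by rcases hs with rfl | rfl <;> norm_num
  have hdef' : ∀ a : Fin 3 → ℝ, ∀ k, a k ≠ 0 → 0 < s * pfaffian (∑ i, a i • ζ i) :=
    fun a k hk => hdef a (sum_smul_ne_zero_of_linearIndependent hli a k hk)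
  -- step 1: normalise `ζ₀`
  have hP0 : 0 < s * pfaffian (ζ 0) := by
    simpa [Fin.sum_univ_three] using hdef' ![1, 0, 0] 0 (by simp)
  set c₀ : ℝ := (Real.sqrt (s * pfaffian (ζ 0)))⁻¹ with hc₀
  have hc₀0 : c₀ ≠ 0 := inv_ne_zero (Real.sqrt_pos.2 hP0).ne'
  set η₁ : E4 [⋀^Fin 2]→L[ℝ] ℝ := c₀ • ζ 0 with hη₁
  have hη₁P : pfaffian η₁ = s := pfaffian_normalize hs hP0
  -- step 2: orthogonalise `ζ₁` against `η₁`, normalise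
  set t₁ : ℝ := pfaffianPair η₁ (ζ 1) / (2 * s) with ht₁
  set ζ₁ : E4 [⋀^Fin 2]→L[ℝ] ℝ := ζ 1 - t₁ • η₁ with hζ₁
  have hζ₁orth : pfaffianPair η₁ ζ₁ = 0 := pfaffianPair_orthogonalize hs0 hη₁P (ζ 1)
  have hζ₁eq : ζ₁ = ∑ i, (![-(t₁ * c₀), 1, 0] : Fin 3 → ℝ) i • ζ i := by
    simp only [Fin.sum_univ_three, Matrix.cons_val_zero, Matrix.cons_val_one, Matrix.cons_val]
    rw [hζ₁, hη₁]
    module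
  have hP1 : 0 < s * pfaffian ζ₁ := by
    rw [hζ₁eq]
    exact hdef' _ 1 (by simp)
  set c₁ : ℝ := (Real.sqrt (s * pfaffian ζ₁))⁻¹ with hc₁
  have hc₁0 : c₁ ≠ 0 := inv_ne_zero (Real.sqrt_pos.2 hP1).ne'
  set η₂ : E4 [⋀^Fin 2]→L[ℝ] ℝ := c₁ • ζ₁ with hη₂
  have hη₂P : pfaffian η₂ = s := pfaffian_normalize hs hP1
  have h12 : pfaffianPair η₁ η₂ = 0 := by rw [hη₂, pfaffianPair_smul_right, hζ₁orth, mul_zero]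
  -- step 3: orthogonalise `ζ₂` against `η₁, η₂`, normalise
  set u₁ : ℝ := pfaffianPair η₁ (ζ 2) / (2 * s) with hu₁
  set u₂ : ℝ := pfaffianPair η₂ (ζ 2) / (2 * s) with hu₂
  set ζ₂ : E4 [⋀^Fin 2]→L[ℝ] ℝ := ζ 2 - u₁ • η₁ - u₂ • η₂ with hζ₂
  have hζ₂orth₁ : pfaffianPair η₁ ζ₂ = 0 := by
    rw [hζ₂, pfaffianPair_sub_right, pfaffianPair_smul_right, h12, mul_zero, sub_zero]
    exact pfaffianPair_orthogonalize hs0 hη₁P (ζ 2)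
  have hζ₂orth₂ : pfaffianPair η₂ ζ₂ = 0 := by
    rw [hζ₂, sub_right_comm, pfaffianPair_sub_right, pfaffianPair_smul_right,
      pfaffianPair_comm η₂ η₁, h12, mul_zero, sub_zero]
    exact pfaffianPair_orthogonalize hs0 hη₂P (ζ 2)
  have hζ₂eq :
      ζ₂ = ∑ i, (![u₂ * c₁ * t₁ * c₀ - u₁ * c₀, -(u₂ * c₁), 1] : Fin 3 → ℝ) i • ζ i := by
    simp only [Fin.sum_univ_three, Matrix.cons_val_zero, Matrix.cons_val_one, Matrix.cons_val]
    rw [hζ₂, hη₂, hζ₁, hη₁]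
    module
  have hP2 : 0 < s * pfaffian ζ₂ := by
    rw [hζ₂eq]
    exact hdef' _ 2 (by simp)
  set c₂ : ℝ := (Real.sqrt (s * pfaffian ζ₂))⁻¹ with hc₂
  have hc₂0 : c₂ ≠ 0 := inv_ne_zero (Real.sqrt_pos.2 hP2).ne'
  set η₃ : E4 [⋀^Fin 2]→L[ℝ] ℝ := c₂ • ζ₂ with hη₃
  have hη₃P : pfaffian η₃ = s := pfaffian_normalize hs hP2
  have h13 : pfaffianPair η₁ η₃ = 0 := by rw [hη₃, pfaffianPair_smul_right, hζ₂orth₁, mul_zero]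
  have h23 : pfaffianPair η₂ η₃ = 0 := by rw [hη₃, pfaffianPair_smul_right, hζ₂orth₂, mul_zero]
  have hW : IsWedgeOrthonormalTriple η₁ η₂ η₃ s := ⟨hs0, hη₁P, hη₂P, hη₃P, h12, h13, h23⟩
  -- the triangular change of basis and its inverse
  refine ⟨![η₁, η₂, η₃],
    ![![c₀, 0, 0], ![-(c₁ * t₁ * c₀), c₁, 0],
      ![c₂ * (u₂ * c₁ * t₁ * c₀ - u₁ * c₀), -(c₂ * u₂ * c₁), c₂]],
    ![![c₀⁻¹, 0, 0], ![t₁, c₁⁻¹, 0], ![u₁, u₂, c₂⁻¹]], ?_, ?_, hW⟩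
  · intro k
    fin_cases k
    · simp only [Fin.sum_univ_three, Fin.zero_eta, Fin.isValue, Matrix.cons_val_zero,
        Matrix.cons_val_one, Matrix.cons_val]
      rw [hη₁]
      module
    · simp only [Fin.sum_univ_three, Fin.mk_one, Fin.isValue, Matrix.cons_val_zero,
        Matrix.cons_val_one, Matrix.cons_val]
      rw [hη₂, hζ₁, hη₁]
      module
    · simp only [Fin.sum_univ_three, Fin.reduceFinMk, Fin.isValue, Matrix.cons_val_zero,
        Matrix.cons_val_one, Matrix.cons_val]
      rw [hη₃, hζ₂, hη₂, hζ₁, hη₁]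
      module
  · intro i
    fin_cases i
    · simp only [Fin.sum_univ_three, Fin.zero_eta, Fin.isValue, Matrix.cons_val_zero,
        Matrix.cons_val_one, Matrix.cons_val]
      rw [hη₁, smul_smul, inv_mul_cancel₀ hc₀0]
      module
    · simp only [Fin.sum_univ_three, Fin.mk_one, Fin.isValue, Matrix.cons_val_zero,
        Matrix.cons_val_one, Matrix.cons_val]
      rw [hη₂, inv_smul_smul₀ hc₁0, hζ₁]
      module
    · simp only [Fin.sum_univ_three, Fin.reduceFinMk, Fin.isValue, Matrix.cons_val_zero,
        Matrix.cons_val_one, Matrix.cons_val]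
      rw [hη₃, inv_smul_smul₀ hc₂0, hζ₂]
      module

/-- The Gram matrix of a wedge-orthonormal triple: `⟨η_i, η_k⟩ = 2s δ_ik`. [folklore] -/
theorem IsWedgeOrthonormalTriple.pfaffianPair_eq_ite {η : Fin 3 → E4 [⋀^Fin 2]→L[ℝ] ℝ}
    (h : IsWedgeOrthonormalTriple (η 0) (η 1) (η 2) s) (i k : Fin 3) :
    pfaffianPair (η i) (η k) = if i = k then 2 * s else 0 := by
  fin_cases i <;> fin_cases k
  · simpa [pfaffianPair_self] using h.pf₁
  · simpa using h.orth₁₂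
  · simpa using h.orth₁₃
  · rw [pfaffianPair_comm]; simpa using h.orth₁₂
  · simpa [pfaffianPair_self] using h.pf₂
  · simpa using h.orth₂₃
  · rw [pfaffianPair_comm]; simpa using h.orth₁₃
  · rw [pfaffianPair_comm]; simpa using h.orth₂₃
  · simpa [pfaffianPair_self] using h.pf₃

/-- Coefficients against a wedge-orthonormal triple: `⟨Σ a_i η_i, η_k⟩ = 2s a_k`. [folklore] -/
theorem IsWedgeOrthonormalTriple.pfaffianPair_sum_smul {η : Fin 3 → E4 [⋀^Fin 2]→L[ℝ] ℝ}
    (h : IsWedgeOrthonormalTriple (η 0) (η 1) (η 2) s) (a : Fin 3 → ℝ) (k : Fin 3) :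
    pfaffianPair (∑ i, a i • η i) (η k) = 2 * s * a k := by
  rw [pfaffianPair_sum_smul_left]
  simp only [h.pfaffianPair_eq_ite, mul_ite, mul_zero, Finset.sum_ite_eq', Finset.mem_univ, if_true]
  ring

/-- A wedge-orthonormal triple is linearly independent. [folklore] -/
theorem IsWedgeOrthonormalTriple.linearIndependent_triple {η : Fin 3 → E4 [⋀^Fin 2]→L[ℝ] ℝ}
    (h : IsWedgeOrthonormalTriple (η 0) (η 1) (η 2) s) : LinearIndependent ℝ η := by
  rw [Fintype.linearIndependent_iff]
  intro a ha k
  have := h.pfaffianPair_sum_smul a k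
  rw [ha, pfaffianPair_zero_left] at this
  have hs0 : s ≠ 0 := h.p_ne
  have : 2 * s * a k = 0 := this.symm
  simpa [hs0] using this

/-- **Expansion against a wedge-orthonormal triple**: a combination `ζ` of the `η_k` is
`ζ = Σ_k (⟨ζ, η_k⟩ / 2s) η_k`. [folklore] -/
theorem IsWedgeOrthonormalTriple.eq_sum_pfaffianPair_smul {η : Fin 3 → E4 [⋀^Fin 2]→L[ℝ] ℝ}
    (h : IsWedgeOrthonormalTriple (η 0) (η 1) (η 2) s) {ζ : E4 [⋀^Fin 2]→L[ℝ] ℝ}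
    {a : Fin 3 → ℝ} (hζ : ζ = ∑ k, a k • η k) :
    ζ = ∑ k, (pfaffianPair ζ (η k) / (2 * s)) • η k := by
  subst hζ
  have hs0 : s ≠ 0 := h.p_ne
  refine Finset.sum_congr rfl fun k _ => ?_
  rw [h.pfaffianPair_sum_smul a k, mul_div_cancel_left₀ _ (mul_ne_zero two_ne_zero hs0)]

end GramSchmidt

/-! ### The adapted frame of a gradient with definite image -/

/-- A basis of `ℝ⁴` whose last vector is a prescribed non-zero vector. [folklore] -/
theorem exists_linearIndependent_last_eq {τ : E4} (hτ : τ ≠ 0) :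
    ∃ w : Fin 4 → E4, LinearIndependent ℝ w ∧ w 3 = τ := by
  have h1 : LinearIndependent ℝ ![τ] := by
    rw [linearIndependent_unique_iff]
    exact hτ
  obtain ⟨x₁, h2⟩ := exists_linearIndependent_cons_of_lt_finrank h1 (by simp)
  obtain ⟨x₂, h3⟩ := exists_linearIndependent_cons_of_lt_finrank h2 (by simp)
  obtain ⟨x₃, h4⟩ := exists_linearIndependent_cons_of_lt_finrank h3 (by simp)
  exact ⟨_, h4, rfl⟩

/-- **Adapted frame for a linear map `G : ℝ⁴ → Λ²(ℝ⁴)*` of rank `3` with definite image.**  If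
the non-zero values of `G` have Pfaffian of the constant sign `s = ±1`, and `τ ≠ 0` lies in the
kernel of `G`, then there are `A ∈ GL(ℝ⁴)` with `A e₀ = τ`, `c ≠ 0`, and a wedge-orthonormal
triple `η` of Pfaffian `s` in `im G` such that `η_i(Au, Av) = c β_i(u, v)` for the standard
self-dual forms `β_i`, and every value of `G` expands as `G W = Σ_k (⟨G W, η_k⟩/2s) η_k`.
(Complete `τ` to a basis `w` of `ℝ⁴`; since `ker G = ℝτ` by rank–nullity, the `G w_i`, `i < 3`,
are independent and span `im G`; Gram–Schmidt them, then take the quaternionic frame of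
`SelfDualTripleFrame.lean` at `x = τ`.) [cite: Perutz2006, Lemma 2.1 (b)] -/
theorem exists_adaptedFrame_of_definiteImage (G : E4 →L[ℝ] (E4 [⋀^Fin 2]→L[ℝ] ℝ)) {s : ℝ}
    (hs : s = 1 ∨ s = -1) (hrank : Module.finrank ℝ (LinearMap.range G.toLinearMap) = 3)
    (hdef : ∀ W, G W ≠ 0 → 0 < s * pfaffian (G W)) {τ : E4} (hτ : τ ≠ 0) (hGτ : G τ = 0) :
    ∃ (A : E4 ≃L[ℝ] E4) (c : ℝ) (η : Fin 3 → E4 [⋀^Fin 2]→L[ℝ] ℝ),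
      c ≠ 0 ∧ A (stdVec 0) = τ ∧ IsWedgeOrthonormalTriple (η 0) (η 1) (η 2) s ∧
      (∀ i, η i ∈ LinearMap.range G.toLinearMap) ∧
      (∀ u v, η 0 ![A u, A v] = c * hondaBeta₁ ![u, v]) ∧
      (∀ u v, η 1 ![A u, A v] = c * hondaBeta₂ ![u, v]) ∧
      (∀ u v, η 2 ![A u, A v] = c * hondaBeta₃ ![u, v]) ∧
      ∀ W, G W = ∑ k, (pfaffianPair (G W) (η k) / (2 * s)) • η k := by
  -- (1) `ker G = ℝ τ` by rank–nullity
  have hker1 : Module.finrank ℝ (LinearMap.ker G.toLinearMap) = 1 := by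
    have hrn := LinearMap.finrank_range_add_finrank_ker G.toLinearMap
    rw [hrank, finrank_euclideanSpace_fin] at hrn
    omega
  have hker : ∀ u, G u = 0 → ∃ c : ℝ, c • τ = u := by
    intro u hu
    have hτk : (⟨τ, LinearMap.mem_ker.2 hGτ⟩ : LinearMap.ker G.toLinearMap) ≠ 0 :=
      fun h0 => hτ (congrArg Subtype.val h0)
    obtain ⟨c, hc⟩ :=
      (finrank_eq_one_iff_of_nonzero' _ hτk).1 hker1 ⟨u, LinearMap.mem_ker.2 hu⟩
    exact ⟨c, congrArg Subtype.val hc⟩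
  -- (2) a basis `w` of `ℝ⁴` ending with `τ`; the independent triple `ζ_i = G w_i`, `i < 3`
  obtain ⟨w, hw, hw3⟩ := exists_linearIndependent_last_eq hτ
  set ζ : Fin 3 → E4 [⋀^Fin 2]→L[ℝ] ℝ := fun i => G (w (Fin.castSucc i)) with hζ
  have hGsum : ∀ a : Fin 3 → ℝ, ∑ i, a i • ζ i = G (∑ i, a i • w (Fin.castSucc i)) := by
    intro a
    simp only [hζ, map_sum, map_smul]
  have hliζ : LinearIndependent ℝ ζ := by
    rw [Fintype.linearIndependent_iff]
    intro a ha i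
    rw [hGsum] at ha
    obtain ⟨c, hc⟩ := hker _ ha
    have hrel : ∑ j, (Fin.snoc a (-c) : Fin 4 → ℝ) j • w j = 0 := by
      rw [Fin.sum_univ_castSucc]
      simp only [Fin.snoc_castSucc, Fin.snoc_last]
      rw [← hc, show w (Fin.last 3) = τ from hw3, neg_smul, add_neg_cancel]
    simpa using Fintype.linearIndependent_iff.1 hw _ hrel (Fin.castSucc i)
  have hdefζ : ∀ a : Fin 3 → ℝ, ∑ i, a i • ζ i ≠ 0 → 0 < s * pfaffian (∑ i, a i • ζ i) := by
    intro a ha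
    rw [hGsum] at ha ⊢
    exact hdef _ ha
  -- (3) Gram–Schmidt and the quaternionic frame at `τ`
  obtain ⟨η, m, n, hm, hn, hη⟩ := exists_wedgeOrthonormalTriple_of_definite hs ζ hliζ hdefζ
  obtain ⟨A, c, hc, hA0, h1, h2, h3⟩ := hη.exists_frame_eq_smul_hondaBeta hτ
  have hηV : ∀ k, η k ∈ LinearMap.range G.toLinearMap := fun k =>
    ⟨∑ i, m k i • w (Fin.castSucc i), ((hm k).trans (hGsum (m k))).symm⟩
  -- (4) every value of `G` is a combination of the `η_k`
  have hexp : ∀ W, ∃ a : Fin 3 → ℝ, G W = ∑ k, a k • η k := by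
    intro W
    set bw := basisOfLinearIndependentOfCardEqFinrank hw (by simp) with hbw
    have hW : ∑ j, bw.repr W j • w j = W := by
      conv_rhs => rw [← bw.sum_repr W]
      simp [hbw]
    refine ⟨fun k => ∑ i, bw.repr W (Fin.castSucc i) * n i k, ?_⟩
    calc G W = ∑ i : Fin 3, bw.repr W (Fin.castSucc i) • ζ i := by
          conv_lhs => rw [← hW]
          rw [map_sum, Fin.sum_univ_castSucc]
          simp only [map_smul, hζ]
          rw [show w (Fin.last 3) = τ from hw3, hGτ, smul_zero, add_zero]
      _ = ∑ k, (∑ i, bw.repr W (Fin.castSucc i) * n i k) • η k := by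
          simp only [hn, Finset.smul_sum, smul_smul, Finset.sum_smul]
          rw [Finset.sum_comm]
  refine ⟨A, c, η, hc, hA0, hη, hηV, h1, h2, h3, fun W => ?_⟩
  obtain ⟨a, ha⟩ := hexp W
  exact hη.eq_sum_pfaffianPair_smul ha

/-- **The gradient in the adapted frame**: under the hypotheses of
`exists_adaptedFrame_of_definiteImage`, with the frame `A`, the scale `c` and the triple `η`
it provides, `G(AW)(AU, AV) = c Σ_k (⟨G(AW), η_k⟩ / 2s) β_k(U, V)` — the gradient is
`x ↦ x · S · β` in the frame, `S_k(W) = ⟨G(AW), η_k⟩ / 2s` (Perutz 2006, §3: the expansion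
`ω(t, x) = x · S(t) β + O(|x|²)`). [cite: Perutz2006, §3 (proof of Lemma 3.1)] -/
theorem gradient_frame_apply {G : E4 →L[ℝ] (E4 [⋀^Fin 2]→L[ℝ] ℝ)} {s c : ℝ} {A : E4 ≃L[ℝ] E4}
    {η : Fin 3 → E4 [⋀^Fin 2]→L[ℝ] ℝ}
    (h1 : ∀ u v, η 0 ![A u, A v] = c * hondaBeta₁ ![u, v])
    (h2 : ∀ u v, η 1 ![A u, A v] = c * hondaBeta₂ ![u, v])
    (h3 : ∀ u v, η 2 ![A u, A v] = c * hondaBeta₃ ![u, v])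
    (hexp : ∀ W, G W = ∑ k, (pfaffianPair (G W) (η k) / (2 * s)) • η k) (W U V : E4) :
    G (A W) ![A U, A V] =
      c * (pfaffianPair (G (A W)) (η 0) / (2 * s) * hondaBeta₁ ![U, V] +
        pfaffianPair (G (A W)) (η 1) / (2 * s) * hondaBeta₂ ![U, V] +
        pfaffianPair (G (A W)) (η 2) / (2 * s) * hondaBeta₃ ![U, V]) := by
  conv_lhs => rw [hexp (A W)]
  simp only [Fin.sum_univ_three, ContinuousAlternatingMap.add_apply,
    ContinuousAlternatingMap.smul_apply, smul_eq_mul, h1, h2, h3]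
  ring

/-! ### At a positive zero of a form on a `4`-manifold -/

section Manifold

variable {M : Type*} [TopologicalSpace M] [ChartedSpace E4 M] [IsManifold (𝓡 4) ∞ M]
  {o : SmoothOrientation (𝓡 4) M} {α : MForm (𝓡 4) M ℝ 2} {x : M}

/-- **Uniform sign of the gradient image at a positive zero**: there is `s = ±1` with
`s · Pf(∇_W α) > 0` for every `W` off the kernel (the sign of `o x` read in the chart).
[cite: Perutz2006, Lemma 2.1 (b)] -/
theorem IsPositiveZero.exists_sign (h : IsPositiveZero o α x) :
    ∃ s : ℝ, (s = 1 ∨ s = -1) ∧ ∀ W : E4, zeroGradient α x W ≠ 0 → 0 < s * pfaffian (zeroGradient α x W) := by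
  set G := zeroGradient α x with hG
  -- a reference vector off the kernel (the gradient has rank `3 ≠ 0`)
  have hex : ∃ W₀ : E4, G W₀ ≠ 0 := by
    by_contra hall
    push Not at hall
    have hzero : G.toLinearMap = 0 := LinearMap.ext hall
    have hr := h.1.finrank_range_eq
    rw [← hG, hzero, LinearMap.range_zero, finrank_bot] at hr
    exact absurd hr (by norm_num)
  obtain ⟨W₀, hW₀⟩ := hex
  by_cases hpos : 0 < pfaffian (G W₀)
  · refine ⟨1, Or.inl rfl, fun W hW => ?_⟩
    have hiff := signOrientationIn_eq_iff.1 (((h.2 W hW).2).symm.trans (h.2 W₀ hW₀).2)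
    rw [one_mul]; exact hiff.2 hpos
  · refine ⟨-1, Or.inr rfl, fun W hW => ?_⟩
    have hiff := signOrientationIn_eq_iff.1 (((h.2 W hW).2).symm.trans (h.2 W₀ hW₀).2)
    have hne := (h.2 W hW).1
    have hnot : ¬ 0 < pfaffian (G W) := fun h' => hpos (hiff.1 h')
    have hlt : pfaffian (G W) < 0 := lt_of_le_of_ne (not_lt.1 hnot) hne
    linarith

/-- **The adapted frame at a positive zero** (Perutz 2006, Lemma 2.1 (b) with the quaternionic
frame, first vector prescribed): at a positive zero `x` of `α`, for every `τ ≠ 0` in the kernel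
of the gradient (the tangent direction of the zero set), there are a sign `s = ±1`, a frame
`A ∈ GL(ℝ⁴)` of the chart tangent space with `A e₀ = τ`, a scale `c ≠ 0` and a wedge-orthonormal
triple `η` of Pfaffian `s` in the image of `∇α(x)`, with `η_i(Au, Av) = c β_i(u, v)` and
`∇_W α = Σ_k (⟨∇_W α, η_k⟩/2s) η_k` for all `W` — so that in the frame `A` the gradient reads
`x ↦ x · S · β` with `S` a `4 × 3` matrix vanishing on `e₀`.
[cite: Perutz2006, Lemma 2.1 (b)] -/
theorem IsPositiveZero.exists_adaptedFrame (h : IsPositiveZero o α x) {τ : E4} (hτ : τ ≠ 0)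
    (hτ0 : zeroGradient α x τ = 0) :
    ∃ (s : ℝ) (A : E4 ≃L[ℝ] E4) (c : ℝ) (η : Fin 3 → E4 [⋀^Fin 2]→L[ℝ] ℝ),
      (s = 1 ∨ s = -1) ∧ c ≠ 0 ∧ A (stdVec 0) = τ ∧ IsWedgeOrthonormalTriple (η 0) (η 1) (η 2) s ∧
      (∀ i, η i ∈ LinearMap.range (zeroGradient α x).toLinearMap) ∧
      (∀ u v, η 0 ![A u, A v] = c * hondaBeta₁ ![u, v]) ∧
      (∀ u v, η 1 ![A u, A v] = c * hondaBeta₂ ![u, v]) ∧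
      (∀ u v, η 2 ![A u, A v] = c * hondaBeta₃ ![u, v]) ∧
      ∀ W, zeroGradient α x W =
        ∑ k, (pfaffianPair (zeroGradient α x W) (η k) / (2 * s)) • η k := by
  obtain ⟨s, hs, hdef⟩ := h.exists_sign
  obtain ⟨A, c, η, hc, hA0, hη, hηV, h1, h2, h3, hexp⟩ :=
    exists_adaptedFrame_of_definiteImage (zeroGradient α x) hs h.1.finrank_range_eq hdef hτ hτ0
  exact ⟨s, A, c, η, hs, hc, hA0, hη, hηV, h1, h2, h3, hexp⟩

end Manifold

end Literature.Geometry.Symplectic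

end
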